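import Mathlib.Topology.MetricSpace.Contracting
import Mathlib.Analysis.Normed.Group.Basic
import Mathlib.Analysis.Normed.Module.Basic
import HarnessLib

/-!
# Fixed points of quadratically small maps with parameters (Chodosh–Shlapentokh-Rothman, §4)

Topic `Literature/Analysis/Calculus`. This file proves the two abstract fixed point lemmas of
§4 ("Two fixed point lemmas", pp. 16–17 of arXiv:1510.08025) of O. Chodosh,
Y. Shlapentokh-Rothman, *Time-periodic Einstein–Klein–Gordon bifurcations of Kerr*, Comm. Math.
Phys. 356 (2017) 1155–1250 — the functional-analytic engine with which every renormalised
unknown of the hairy-Kerr construction is solved for (CSR §7.2, §8.2, §9.2, §10.2, §11.4, §12),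
hence a node of the decomposition of the barrier fact
`Literature.Barriers.FinalStateConjecture.HairyKerrBifurcation` (CSR Thm. 1.1) recorded in
`Literature/Barriers/FinalStateConjecture/HairyKerrBifurcation.lean`.

**Lemma 4.0.3** (p. 16). Banach spaces `𝓛, 𝓠, 𝓟`, `ε > 0`, a map
`𝔗 : B_ε(𝓛) × B_ε(𝓠) × B_ε(𝓟) → B_ε(𝓛)` with, for a constant `D > 0`,
`‖𝔗(l, q, p)‖ ≤ D [‖l‖² + ‖q‖²]` and
`‖𝔗(l₁,q₁,p₁) − 𝔗(l₂,q₂,p₂)‖ ≤ D [(‖l₁‖ + ‖l₂‖)‖l₁ − l₂‖ + (‖q₁‖ + ‖q₂‖)‖q₁ − q₂‖ + ‖p₁ − p₂‖]`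
on these balls. "Then, after possibly shrinking `ε`, there exists a 'solution map'
`𝔖 : B_ε(𝓠) × B_ε(𝓟) → B_ε(𝓛)` such that `𝔗(𝔖(q,p), q, p) = 𝔖(q,p)`,
`‖𝔖(q,p)‖ ≤ D ‖q‖²`, and
`‖𝔖(q₁,p₁) − 𝔖(q₂,p₂)‖ ≤ D [(‖q₁‖ + ‖q₂‖)‖q₁ − q₂‖ + ‖p₁ − p₂‖]`" (each with its own
constant `D > 0`). Proof as printed: "For `ε` sufficiently small, the map `𝔗(·, p, q)` is
easily seen to be a contraction map and thus has a fixed point `𝔖(p, q)`. The asserted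
properties of `𝔖` are immediate consequences of the corresponding properties of `𝔗`."

**Lemma 4.0.4** (pp. 16–17) is its linearised form: for `𝔈(l, q) = L(l) − N(l, q)` with a
bounded right inverse `L⁻¹ : 𝒩 → 𝓛` of the linear operator `L` on a Banach space `𝒩 ⊆ 𝓛̃`
containing the values of `N`, and `N` quadratically small and Lipschitz in the above sense
(in the norm of `𝒩`), there is a solution map `𝔖` with `𝔈(𝔖(q), q) = 0`, `‖𝔖(q)‖ ≤ D‖q‖²`,
`‖𝔖(q₁) − 𝔖(q₂)‖ ≤ D (‖q₁‖ + ‖q₂‖)‖q₁ − q₂‖`; "one defines `𝔗(l, q) ≐ L⁻¹(N(l, q))` and checks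
that Lemma 4.0.3 applies."

## Rendering

* Maps are total functions `T : 𝓛 → 𝓠 → 𝓟 → 𝓛`; the hypotheses are imposed on the open
  `ε`-balls (`‖l‖ < ε`, …), and the printed codomain restriction `𝔗(…) ∈ B_ε(𝓛)` is dropped (it
  is implied by the quadratic bound once `ε` is shrunk, which the conclusion allows).
* Only the norms are used: `𝓛` is a complete normed group, `𝓠`, `𝓟` (semi)normed groups — the
  linear structure of the printed Banach spaces plays no role in Lemma 4.0.3.
* The conclusion provides `ε' ∈ (0, ε]`, one constant `D' > 0` serving all the estimates, the
  solution map `S : 𝓠 → 𝓟 → 𝓛` (junk value `0` off the `ε'`-balls), and, beyond the printed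
  statement, uniqueness of the fixed point of `T(·, q, p)` in the `ε'`-ball (last clause of
  `exists_quadraticSolutionMap`), which is what "the" fixed point of a contraction means in the
  printed proof.
* Lemma 4.0.4: `𝒩` is a (semi)normed group of its own, mapped into the type `𝓛̃` by `ι` (the
  inclusion `𝒩 ⊆ 𝓛̃`); `L : 𝓛 → 𝓛̃` is any map; the bounded right inverse is an additive
  homomorphism `L⁻¹ : 𝒩 →+ 𝓛` with `‖L⁻¹ H‖ ≤ C‖H‖` and `L (L⁻¹ H) = ι H`; `N : 𝓛 → 𝓠 → 𝒩`, and
  the equation `𝔈(S q, q) = 0` reads `L (S q) = ι (N (S q) q)`.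

Mathlib: the Banach fixed point theorem on a complete forward-invariant subset,
`ContractingWith.exists_fixedPoint'`; `LipschitzOnWith.of_dist_le_mul`,
`LipschitzOnWith.mapsToRestrict`.

## References

* O. Chodosh, Y. Shlapentokh-Rothman, *Time-periodic Einstein–Klein–Gordon bifurcations of
  Kerr*, Comm. Math. Phys. 356 (2017) 1155–1250, arXiv:1510.08025: §4, Lemma 4.0.3, Remark 4.1,
  Lemma 4.0.4, Remark 4.2 (pp. 16–17). [ChodoshShlapentokhrothman2017]
-/

open Set Metric Function

noncomputable section

namespace Literature.Analysis.Calculus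

/-- **Banach's fixed point theorem on a closed ball of a complete normed group**: a self-map of
`closedBall 0 ρ` which is `K`-Lipschitz there with `K < 1` has a fixed point in the ball
(Mathlib's `ContractingWith.exists_fixedPoint'` on the complete subset `closedBall 0 ρ`).
[folklore] -/
theorem exists_isFixedPt_mem_closedBall {𝓛 : Type*} [NormedAddCommGroup 𝓛] [CompleteSpace 𝓛]
    {f : 𝓛 → 𝓛} {ρ : ℝ} (hρ : 0 ≤ ρ) {K : NNReal} (hK : K < 1)
    (hmaps : MapsTo f (closedBall 0 ρ) (closedBall 0 ρ))
    (hlip : LipschitzOnWith K f (closedBall 0 ρ)) :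
    ∃ y ∈ closedBall (0 : 𝓛) ρ, f y = y := by
  have hsc : IsComplete (closedBall (0 : 𝓛) ρ) := isClosed_closedBall.isComplete
  have hf : ContractingWith K (hmaps.restrict f _ _) := ⟨hK, hlip.mapsToRestrict hmaps⟩
  obtain ⟨y, hy, hfix, -, -⟩ :=
    hf.exists_fixedPoint' hsc hmaps (x := 0) (mem_closedBall_self hρ) (edist_ne_top _ _)
  exact ⟨y, hy, hfix⟩

section Lemma403

variable {𝓛 𝓠 𝓟 : Type*} [NormedAddCommGroup 𝓛] [CompleteSpace 𝓛]
  [SeminormedAddCommGroup 𝓠] [SeminormedAddCommGroup 𝓟]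

/-- **Chodosh–Shlapentokh-Rothman's basic fixed point lemma (Lemma 4.0.3)** for a map
`T : 𝓛 × 𝓠 × 𝓟 → 𝓛` which, on the `ε`-balls, is quadratically small,
`‖T(l,q,p)‖ ≤ D(‖l‖² + ‖q‖²)`, and satisfies
`‖T(l₁,q₁,p₁) − T(l₂,q₂,p₂)‖ ≤ D[(‖l₁‖+‖l₂‖)‖l₁−l₂‖ + (‖q₁‖+‖q₂‖)‖q₁−q₂‖ + ‖p₁−p₂‖]`:
after shrinking `ε` to some `ε' ∈ (0, ε]` there is a solution map `S : 𝓠 × 𝓟 → 𝓛` on the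
`ε'`-balls with values in the `ε'`-ball of `𝓛`, `T(S(q,p), q, p) = S(q,p)`,
`‖S(q,p)‖ ≤ D'‖q‖²`, the "continuous dependence on the parameters"
`‖S(q₁,p₁) − S(q₂,p₂)‖ ≤ D'[(‖q₁‖+‖q₂‖)‖q₁−q₂‖ + ‖p₁−p₂‖]` (Remark 4.1), and `S(q,p)` is the
only fixed point of `T(·, q, p)` in the `ε'`-ball. (`𝓛` complete normed group; `𝓠`, `𝓟`
seminormed groups; `D` any real constant.) Chodosh–Shlapentokh-Rothman, CMP 356 (2017),
Lemma 4.0.3 and Remark 4.1 (p. 16 of arXiv:1510.08025).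
[cite: ChodoshShlapentokhrothman2017, Lemma 4.0.3] -/
theorem exists_quadraticSolutionMap {T : 𝓛 → 𝓠 → 𝓟 → 𝓛} {ε D : ℝ} (hε : 0 < ε)
    (hbound : ∀ l q p, ‖l‖ < ε → ‖q‖ < ε → ‖p‖ < ε → ‖T l q p‖ ≤ D * (‖l‖ ^ 2 + ‖q‖ ^ 2))
    (hlip : ∀ l₁ l₂ q₁ q₂ p₁ p₂, ‖l₁‖ < ε → ‖l₂‖ < ε → ‖q₁‖ < ε → ‖q₂‖ < ε → ‖p₁‖ < ε →
      ‖p₂‖ < ε → ‖T l₁ q₁ p₁ - T l₂ q₂ p₂‖ ≤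
        D * ((‖l₁‖ + ‖l₂‖) * ‖l₁ - l₂‖ + (‖q₁‖ + ‖q₂‖) * ‖q₁ - q₂‖ + ‖p₁ - p₂‖)) :
    ∃ ε' ∈ Ioc 0 ε, ∃ D' > (0 : ℝ), ∃ S : 𝓠 → 𝓟 → 𝓛,
      (∀ q p, ‖q‖ < ε' → ‖p‖ < ε' →
        ‖S q p‖ < ε' ∧ T (S q p) q p = S q p ∧ ‖S q p‖ ≤ D' * ‖q‖ ^ 2) ∧
      (∀ q₁ q₂ p₁ p₂, ‖q₁‖ < ε' → ‖q₂‖ < ε' → ‖p₁‖ < ε' → ‖p₂‖ < ε' →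
        ‖S q₁ p₁ - S q₂ p₂‖ ≤ D' * ((‖q₁‖ + ‖q₂‖) * ‖q₁ - q₂‖ + ‖p₁ - p₂‖)) ∧
      (∀ q p l, ‖q‖ < ε' → ‖p‖ < ε' → ‖l‖ < ε' → T l q p = l → l = S q p) := by
  -- Step 0: enlarge the constant to `D₁ ≥ 1` and shrink `ε` to `ε' ≤ 1 / (8 D₁)`
  set D₁ := max D 1 with hD₁_def
  have hD₁ : 1 ≤ D₁ := le_max_right _ _
  have hD₁pos : 0 < D₁ := by positivity
  have hDD₁ : D ≤ D₁ := le_max_left _ _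
  have hbound₁ : ∀ l q p, ‖l‖ < ε → ‖q‖ < ε → ‖p‖ < ε →
      ‖T l q p‖ ≤ D₁ * (‖l‖ ^ 2 + ‖q‖ ^ 2) := fun l q p hl hq hp ↦
    (hbound l q p hl hq hp).trans (mul_le_mul_of_nonneg_right hDD₁ (by positivity))
  have hlip₁ : ∀ l₁ l₂ q₁ q₂ p₁ p₂, ‖l₁‖ < ε → ‖l₂‖ < ε → ‖q₁‖ < ε → ‖q₂‖ < ε → ‖p₁‖ < ε →
      ‖p₂‖ < ε → ‖T l₁ q₁ p₁ - T l₂ q₂ p₂‖ ≤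
        D₁ * ((‖l₁‖ + ‖l₂‖) * ‖l₁ - l₂‖ + (‖q₁‖ + ‖q₂‖) * ‖q₁ - q₂‖ + ‖p₁ - p₂‖) :=
    fun l₁ l₂ q₁ q₂ p₁ p₂ h1 h2 h3 h4 h5 h6 ↦
      (hlip l₁ l₂ q₁ q₂ p₁ p₂ h1 h2 h3 h4 h5 h6).trans
        (mul_le_mul_of_nonneg_right hDD₁ (by positivity))
  set ε' := min ε (1 / (8 * D₁)) with hε'_def
  have hε' : 0 < ε' := by positivity
  have hε'ε : ε' ≤ ε := min_le_left _ _
  have hε'D : D₁ * ε' ≤ 1 / 8 := by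
    have : ε' ≤ 1 / (8 * D₁) := min_le_right _ _
    rw [le_div_iff₀ (by positivity)] at this
    linarith
  -- the radius `ρ q = 2 D₁ ‖q‖²` of the ball in which the fixed point is sought
  have hρ : ∀ {q : 𝓠}, ‖q‖ < ε' →
      0 ≤ 2 * D₁ * ‖q‖ ^ 2 ∧ 2 * D₁ * ‖q‖ ^ 2 ≤ ε' / 4 ∧ D₁ * (2 * D₁ * ‖q‖ ^ 2) ≤ 1 / 32 := by
    intro q hq
    have hq0 : 0 ≤ ‖q‖ := norm_nonneg q
    have hq2 : ‖q‖ ^ 2 ≤ ε' ^ 2 := by nlinarith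
    refine ⟨by positivity, ?_, ?_⟩
    · nlinarith
    · have h1 : (D₁ * ε') ^ 2 ≤ (1 / 8) ^ 2 := pow_le_pow_left₀ (by positivity) hε'D 2
      have h2 : D₁ ^ 2 * ‖q‖ ^ 2 ≤ D₁ ^ 2 * ε' ^ 2 := mul_le_mul_of_nonneg_left hq2 (by positivity)
      have h3 : D₁ * (2 * D₁ * ‖q‖ ^ 2) = 2 * (D₁ ^ 2 * ‖q‖ ^ 2) := by ring
      have h4 : D₁ ^ 2 * ε' ^ 2 = (D₁ * ε') ^ 2 := by ring
      rw [h3]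
      linarith
  -- Step 1: for `‖q‖, ‖p‖ < ε'`, `T(·, q, p)` is a `1/16`-contraction of `closedBall 0 (ρ q)`
  have hfix : ∀ q p, ‖q‖ < ε' → ‖p‖ < ε' →
      ∃ y ∈ closedBall (0 : 𝓛) (2 * D₁ * ‖q‖ ^ 2), T y q p = y := by
    intro q p hq hp
    obtain ⟨hρ0, hρε, hρD⟩ := hρ hq
    set ρ := 2 * D₁ * ‖q‖ ^ 2 with hρ_def
    have hρltε : ρ < ε := by linarith
    have hqε : ‖q‖ < ε := hq.trans_le hε'ε
    have hpε : ‖p‖ < ε := hp.trans_le hε'ε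
    have hmaps : MapsTo (fun l ↦ T l q p) (closedBall 0 ρ) (closedBall 0 ρ) := by
      intro l hl
      rw [mem_closedBall, dist_zero_right] at hl ⊢
      have hlε : ‖l‖ < ε := hl.trans_lt hρltε
      have h := hbound₁ l q p hlε hqε hpε
      have hl2 : ‖l‖ ^ 2 ≤ ρ ^ 2 := by nlinarith [norm_nonneg l]
      have hq2 : D₁ * ‖q‖ ^ 2 = ρ / 2 := by rw [hρ_def]; ring
      nlinarith
    have hlipK : LipschitzOnWith (1 / 16 : NNReal) (fun l ↦ T l q p) (closedBall 0 ρ) := by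
      refine LipschitzOnWith.of_dist_le_mul fun l₁ hl₁ l₂ hl₂ ↦ ?_
      rw [mem_closedBall, dist_zero_right] at hl₁ hl₂
      rw [dist_eq_norm, dist_eq_norm]
      have h := hlip₁ l₁ l₂ q q p p (hl₁.trans_lt hρltε) (hl₂.trans_lt hρltε) hqε hqε hpε hpε
      simp only [sub_self, norm_zero, mul_zero, add_zero] at h
      have hcoe : ((1 / 16 : NNReal) : ℝ) = 1 / 16 := by norm_num
      rw [hcoe]
      have : D₁ * (‖l₁‖ + ‖l₂‖) ≤ 1 / 16 := by nlinarith
      nlinarith [norm_nonneg (l₁ - l₂)]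
    exact exists_isFixedPt_mem_closedBall hρ0 (by rw [← NNReal.coe_lt_coe]; norm_num) hmaps hlipK
  -- Step 2: the solution map (junk value `0` off the `ε'`-balls)
  have key : ∀ q p, ∃ y : 𝓛, (‖q‖ < ε' → ‖p‖ < ε' →
      ‖y‖ ≤ 2 * D₁ * ‖q‖ ^ 2 ∧ T y q p = y) := by
    intro q p
    by_cases h : ‖q‖ < ε' ∧ ‖p‖ < ε'
    · obtain ⟨y, hy, hTy⟩ := hfix q p h.1 h.2
      exact ⟨y, fun _ _ ↦ ⟨by rwa [mem_closedBall, dist_zero_right] at hy, hTy⟩⟩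
    · exact ⟨0, fun hq hp ↦ (h ⟨hq, hp⟩).elim⟩
  choose S hS using key
  have hSnorm : ∀ {q p}, ‖q‖ < ε' → ‖p‖ < ε' → ‖S q p‖ ≤ 2 * D₁ * ‖q‖ ^ 2 :=
    fun hq hp ↦ (hS _ _ hq hp).1
  have hSfix : ∀ {q p}, ‖q‖ < ε' → ‖p‖ < ε' → T (S q p) q p = S q p :=
    fun hq hp ↦ (hS _ _ hq hp).2
  have hSlt : ∀ {q p}, ‖q‖ < ε' → ‖p‖ < ε' → ‖S q p‖ < ε' := fun hq hp ↦ by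
    have := hSnorm hq hp
    have := (hρ hq).2.1
    linarith
  -- Step 3: uniqueness in the `ε'`-ball and Lipschitz dependence on the parameters
  have huniq : ∀ q p l, ‖q‖ < ε' → ‖p‖ < ε' → ‖l‖ < ε' → T l q p = l → l = S q p := by
    intro q p l hq hp hl hTl
    have hqε : ‖q‖ < ε := hq.trans_le hε'ε
    have hpε : ‖p‖ < ε := hp.trans_le hε'ε
    have h := hlip₁ l (S q p) q q p p (hl.trans_le hε'ε) ((hSlt hq hp).trans_le hε'ε)
      hqε hqε hpε hpε
    rw [hTl, hSfix hq hp] at h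
    simp only [sub_self, norm_zero, mul_zero, add_zero] at h
    have hsmall : D₁ * (‖l‖ + ‖S q p‖) ≤ 1 / 4 := by
      have := hSlt hq hp
      nlinarith
    have hn : 0 ≤ ‖l - S q p‖ := norm_nonneg _
    have : ‖l - S q p‖ ≤ 1 / 4 * ‖l - S q p‖ := by nlinarith
    have h0 : ‖l - S q p‖ = 0 := by linarith
    exact sub_eq_zero.mp (norm_eq_zero.mp h0)
  refine ⟨ε', ⟨hε', hε'ε⟩, 2 * D₁, by positivity, S,
    fun q p hq hp ↦ ⟨hSlt hq hp, hSfix hq hp, hSnorm hq hp⟩, ?_, huniq⟩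
  intro q₁ q₂ p₁ p₂ hq₁ hq₂ hp₁ hp₂
  have h := hlip₁ (S q₁ p₁) (S q₂ p₂) q₁ q₂ p₁ p₂ ((hSlt hq₁ hp₁).trans_le hε'ε)
    ((hSlt hq₂ hp₂).trans_le hε'ε) (hq₁.trans_le hε'ε) (hq₂.trans_le hε'ε)
    (hp₁.trans_le hε'ε) (hp₂.trans_le hε'ε)
  rw [hSfix hq₁ hp₁, hSfix hq₂ hp₂] at h
  have hsmall : D₁ * (‖S q₁ p₁‖ + ‖S q₂ p₂‖) ≤ 1 / 16 := by
    have h1 := hSnorm hq₁ hp₁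
    have h2 := hSnorm hq₂ hp₂
    have h3 := (hρ hq₁).2.2
    have h4 := (hρ hq₂).2.2
    nlinarith
  have hB : 0 ≤ (‖q₁‖ + ‖q₂‖) * ‖q₁ - q₂‖ + ‖p₁ - p₂‖ := by positivity
  have hn : 0 ≤ ‖S q₁ p₁ - S q₂ p₂‖ := norm_nonneg _
  nlinarith

end Lemma403

section Lemma404

variable {𝓛 𝓠 𝒩 : Type*} {𝓛' : Sort*} [NormedAddCommGroup 𝓛] [CompleteSpace 𝓛]
  [SeminormedAddCommGroup 𝓠] [SeminormedAddCommGroup 𝒩]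

/-- **Chodosh–Shlapentokh-Rothman's linearised fixed point lemma (Lemma 4.0.4).** To solve
`𝔈(l, q) = L(l) − N(l, q) = 0` for `l` in terms of the "genuinely nonlinear parameter" `q`:
suppose `L : 𝓛 → 𝓛̃`, the nonlinearity `N : 𝓛 × 𝓠 → 𝒩` takes values in a normed space `𝒩`
included in `𝓛̃` by `ι`, `L⁻¹ : 𝒩 → 𝓛` is a bounded additive right inverse
(`L (L⁻¹ H) = ι H`, `‖L⁻¹ H‖ ≤ C‖H‖`), and on the `ε`-balls `‖N(l, q)‖ ≤ D[‖l‖² + ‖q‖²]`,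
`‖N(l₁,q₁) − N(l₂,q₂)‖ ≤ D[(‖l₁‖+‖l₂‖)‖l₁−l₂‖ + (‖q₁‖+‖q₂‖)‖q₁−q₂‖]`. Then, after shrinking
`ε`, there is a solution map `S : 𝓠 → 𝓛` on the `ε'`-ball with `L(S q) = N(S q, q)` (i.e.
`𝔈(S q, q) = 0`), `‖S q‖ ≤ D'‖q‖²` and the "continuous nonlinear dependence on parameters"
`‖S q₁ − S q₂‖ ≤ D'(‖q₁‖+‖q₂‖)‖q₁−q₂‖` (Remark 4.2); moreover `S q` is the only solution of
`L⁻¹(N(l, q)) = l` in the `ε'`-ball. Proof as printed: apply Lemma 4.0.3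
(`exists_quadraticSolutionMap`) to `𝔗(l, q) = L⁻¹(N(l, q))`. Chodosh–Shlapentokh-Rothman,
CMP 356 (2017), Lemma 4.0.4 and Remark 4.2 (pp. 16–17 of arXiv:1510.08025).
[cite: ChodoshShlapentokhrothman2017, Lemma 4.0.4] -/
theorem exists_quadraticSolutionMap_linearized {Lop : 𝓛 → 𝓛'} {ι : 𝒩 → 𝓛'}
    (Linv : 𝒩 →+ 𝓛) {C : ℝ} (hright : ∀ H, Lop (Linv H) = ι H)
    (hC : ∀ H, ‖Linv H‖ ≤ C * ‖H‖) {N : 𝓛 → 𝓠 → 𝒩} {ε D : ℝ} (hε : 0 < ε)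
    (hN : ∀ l q, ‖l‖ < ε → ‖q‖ < ε → ‖N l q‖ ≤ D * (‖l‖ ^ 2 + ‖q‖ ^ 2))
    (hNlip : ∀ l₁ l₂ q₁ q₂, ‖l₁‖ < ε → ‖l₂‖ < ε → ‖q₁‖ < ε → ‖q₂‖ < ε →
      ‖N l₁ q₁ - N l₂ q₂‖ ≤ D * ((‖l₁‖ + ‖l₂‖) * ‖l₁ - l₂‖ + (‖q₁‖ + ‖q₂‖) * ‖q₁ - q₂‖)) :
    ∃ ε' ∈ Ioc 0 ε, ∃ D' > (0 : ℝ), ∃ S : 𝓠 → 𝓛,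
      (∀ q, ‖q‖ < ε' → ‖S q‖ < ε' ∧ Lop (S q) = ι (N (S q) q) ∧ ‖S q‖ ≤ D' * ‖q‖ ^ 2) ∧
      (∀ q₁ q₂, ‖q₁‖ < ε' → ‖q₂‖ < ε' →
        ‖S q₁ - S q₂‖ ≤ D' * ((‖q₁‖ + ‖q₂‖) * ‖q₁ - q₂‖)) ∧
      (∀ q l, ‖q‖ < ε' → ‖l‖ < ε' → Linv (N l q) = l → l = S q) := by
  -- nonnegative versions of the constants
  set C₁ := max C 0 with hC₁_def
  set D₁ := max D 0 with hD₁_def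
  have hC₁ : 0 ≤ C₁ := le_max_right _ _
  have hD₁ : 0 ≤ D₁ := le_max_right _ _
  have hC' : ∀ H, ‖Linv H‖ ≤ C₁ * ‖H‖ := fun H ↦
    (hC H).trans (mul_le_mul_of_nonneg_right (le_max_left _ _) (norm_nonneg _))
  have hN' : ∀ l q, ‖l‖ < ε → ‖q‖ < ε → ‖N l q‖ ≤ D₁ * (‖l‖ ^ 2 + ‖q‖ ^ 2) :=
    fun l q hl hq ↦ (hN l q hl hq).trans (mul_le_mul_of_nonneg_right (le_max_left _ _)
      (by positivity))
  have hNlip' : ∀ l₁ l₂ q₁ q₂, ‖l₁‖ < ε → ‖l₂‖ < ε → ‖q₁‖ < ε → ‖q₂‖ < ε →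
      ‖N l₁ q₁ - N l₂ q₂‖ ≤
        D₁ * ((‖l₁‖ + ‖l₂‖) * ‖l₁ - l₂‖ + (‖q₁‖ + ‖q₂‖) * ‖q₁ - q₂‖) :=
    fun l₁ l₂ q₁ q₂ h1 h2 h3 h4 ↦ (hNlip l₁ l₂ q₁ q₂ h1 h2 h3 h4).trans
      (mul_le_mul_of_nonneg_right (le_max_left _ _) (by positivity))
  -- the map `𝔗(l, q, p) = L⁻¹ (N (l, q))` (the parameter `p ∈ 𝓠` is a dummy)
  set T : 𝓛 → 𝓠 → 𝓠 → 𝓛 := fun l q _ ↦ Linv (N l q) with hT_def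
  have hbound : ∀ l q p, ‖l‖ < ε → ‖q‖ < ε → ‖p‖ < ε →
      ‖T l q p‖ ≤ C₁ * D₁ * (‖l‖ ^ 2 + ‖q‖ ^ 2) := by
    intro l q p hl hq _
    calc ‖T l q p‖ = ‖Linv (N l q)‖ := rfl
      _ ≤ C₁ * ‖N l q‖ := hC' _
      _ ≤ C₁ * (D₁ * (‖l‖ ^ 2 + ‖q‖ ^ 2)) := mul_le_mul_of_nonneg_left (hN' l q hl hq) hC₁
      _ = C₁ * D₁ * (‖l‖ ^ 2 + ‖q‖ ^ 2) := by ring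
  have hlip : ∀ l₁ l₂ q₁ q₂ (p₁ p₂ : 𝓠), ‖l₁‖ < ε → ‖l₂‖ < ε → ‖q₁‖ < ε → ‖q₂‖ < ε →
      ‖p₁‖ < ε → ‖p₂‖ < ε → ‖T l₁ q₁ p₁ - T l₂ q₂ p₂‖ ≤
        C₁ * D₁ * ((‖l₁‖ + ‖l₂‖) * ‖l₁ - l₂‖ + (‖q₁‖ + ‖q₂‖) * ‖q₁ - q₂‖ + ‖p₁ - p₂‖) := by
    intro l₁ l₂ q₁ q₂ p₁ p₂ h1 h2 h3 h4 _ _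
    calc ‖T l₁ q₁ p₁ - T l₂ q₂ p₂‖ = ‖Linv (N l₁ q₁ - N l₂ q₂)‖ := by
          simp only [hT_def, map_sub]
      _ ≤ C₁ * ‖N l₁ q₁ - N l₂ q₂‖ := hC' _
      _ ≤ C₁ * (D₁ * ((‖l₁‖ + ‖l₂‖) * ‖l₁ - l₂‖ + (‖q₁‖ + ‖q₂‖) * ‖q₁ - q₂‖)) :=
          mul_le_mul_of_nonneg_left (hNlip' l₁ l₂ q₁ q₂ h1 h2 h3 h4) hC₁
      _ ≤ C₁ * D₁ * ((‖l₁‖ + ‖l₂‖) * ‖l₁ - l₂‖ + (‖q₁‖ + ‖q₂‖) * ‖q₁ - q₂‖ + ‖p₁ - p₂‖) := by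
          have : 0 ≤ C₁ * D₁ * ‖p₁ - p₂‖ := by positivity
          nlinarith
  obtain ⟨ε', hε', D', hD', S₃, hS₃, hS₃lip, hS₃uniq⟩ := exists_quadraticSolutionMap hε hbound hlip
  have h0 : ‖(0 : 𝓠)‖ < ε' := by rw [norm_zero]; exact hε'.1
  refine ⟨ε', hε', D', hD', fun q ↦ S₃ q 0, fun q hq ↦ ?_, fun q₁ q₂ hq₁ hq₂ ↦ ?_,
    fun q l hq hl hfix ↦ hS₃uniq q 0 l hq h0 hl hfix⟩
  · obtain ⟨h1, h2, h3⟩ := hS₃ q 0 hq h0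
    have h2' : Linv (N (S₃ q 0) q) = S₃ q 0 := h2
    exact ⟨h1, by rw [← hright, h2'], h3⟩
  · simpa using hS₃lip q₁ q₂ 0 0 hq₁ hq₂ h0 h0

end Lemma404

end Literature.Analysis.Calculus
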